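import Summits.QuantumFields.BalabanUV.Beta.D1BFx.PackedRoadHptw
import Summits.QuantumFields.BalabanUV.Beta.D1BFx.GhostSqrtLegPacked

/-!
# `BalabanUV.Beta.D1BFx.PackedRoadHptwGhost` — road «BF-x» for binder row D1, slot (K): PART 7 «HPTW-GHOST» = PART 6 ∘ «GH-DICT-PACKED» —
# **THE (K) IDENTITY OF THE ROAD IN THE `hptw` SHAPE WITH BOTH MAIN WORDS EXPLICIT.**  PART 6 (`PackedRoadHptw.hessKer_road_hptw_shape`) with its ghost tower
# `hessKer (Cgh (m+1) a) ℒ ℒ₂ μ ν z` rewritten BY NAME through gan24-leaf-05 g52's `GhostSqrtLegPacked.hessKer_Cgh_packed_eq` (the GH-DICT lineage's brick, leaf-04 g16∕g17's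
# bi-Laplacian split in the limit) at the weights `w := colH G₀ (m+1)` (decay letters from `decays_coDressKBmAt_KInvStep` + `colH_weight`, rate `min δG ½`):
# `hessKer G₀ (vertexOfK G₀ n S) (vertex2OfK G₀ n S₂) μ ν z = ¼·TOfLeg n (Ga n a) (blk (coProjBmAtK ρ n (SN m a S)) tt) (2•ffW 𝒲N∞) μ ν z + legCross + blockTerms + 2·hessKer idK1 𝒳 𝒳₂`
# `− (2·hessKer (Ggh n a) (n²•𝒢[colH G₀]) (n²•𝒟[colH G₀]) μ ν z − R₁₆)` — gluon main word AND ghost main word explicit at the road's GAUGED pack, the sixteen ghost rest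
# traces `R₁₆`, the sandwich ∕ block ∕ comb-FP words NAMED.  Toward `hptw` VERBATIM there remain (J1) S-LIT, (J2) the TABLE dictionary, Q-GH-W′ (the END's `wH`-based
# `PghQ` ray vs this gauged ghost word), (D)-II, the (II) rows.

HONEST DEPENDENCY (cell records, verbatim): «continuum YM on T⁴ ⇐ BetaPertH ∧ nine spine estimates (0/9 proved); BetaPertH ⇐ (D1) ∧ (D4) ∧
CAP+tail; G-an2-4 gates asym, D1 and NE2/3/4.»  HONEST FRAMING (cell contract, verbatim): «discharging `BetaPertH` makes Bałaban's UV stability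
UNCONDITIONAL — a real constructive-QFT result; it is NOT the continuum limit and NOT the Clay problem.»  THIS MODULE DISCHARGES NOTHING of (K),
of D1 or of the wall: [folklore] two rewrites BY NAME; every hypothesis of PART 6 stays DISPLAYED.  No definition, no `def … : Prop`, nothing cited, 0 sorry.
0 root-level binders of row D1 discharged; (K) NOT closed; NOT D1, NOT `BetaPertH`, NOT continuum, NOT Clay.

ABSOLUTE RULE (cell charter, verbatim): «No internally-minted statement may enter as a cited fact. Every hypothesis is either kernel-proved in this
package or a verbatim quotation of a PUBLISHED theorem with page reference. The manuscript(s) under audit are NOT citable for their own disputed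
steps — they are the thing under adjudication; programme-internal (2001/route/tribunal) claims are never citable.»

CONTENT (all [folklore]): **`hessKer_road_hptw_ghost_shape`**.  Unit `b2b-balaban-beta-d1-p2` (road owner, gen 18), 2026-08-22.
-/

noncomputable section

namespace Summit.QuantumFields.BalabanUV.Beta.D1BFx.PackedRoadHptwGhost

open Matrix Filter Topology
open scoped BigOperators Kronecker
open Literature.Probability.LatticeModels (TorusSite)
open Literature.MathematicalPhysics.QuantumFieldTheory.Balaban1983to89
open Literature.MathematicalPhysics.QuantumFieldTheory.Balaban1983to89.Beta
open Literature.MathematicalPhysics.QuantumFieldTheory.Balaban1983to89.Beta.Composition (kkt)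
open B12Sec2to5 (l1 l1_nonneg)
open ExpKernelCalculus (MKer Decays BiLoc comp hessKer shiftK Zl)
open AffineAveraging (box toSite unitVec)
open OneStepResolventKernel (Fib wsum LocStencil)
open OneStepKernelFamily (KInvStep colH vertexOfK vertexFamily_vertexOfK)
open SecondOrderResponse (vertex2OfK)
open Summit.QuantumFields.BalabanUV.Beta.TameKernelCalculus (Spr)
open Summit.QuantumFields.BalabanUV.Beta.AxialDressingRooted (coDressKBmAt decays_coDressKBmAt_KInvStep)
open Summit.QuantumFields.BalabanUV.Beta.D1BFx.FibredPeriodisation (periodiseF)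
open Summit.QuantumFields.BalabanUV.Beta.D1BFx.SortedKernels (blocksHat fTL fBL)
open Summit.QuantumFields.BalabanUV.Beta.D1BFx.SortedPack (sortK)
open Summit.QuantumFields.BalabanUV.Beta.D1BFx.SortedReblocking (torusBlockEquiv)
open Summit.QuantumFields.BalabanUV.Beta.D1BFx.SortedEmbedding (e₁)
open Summit.QuantumFields.BalabanUV.Beta.D1BFx.PeriodicArrays (arr)
open Summit.QuantumFields.BalabanUV.Beta.D1BFx.GramWeightColourLift (tj₂ tgram₁ tgramMix)
open Summit.QuantumFields.BalabanUV.Beta.D1BFx.TorusCombKKT (I J CombRows tauT Khat Qhat)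
open Summit.QuantumFields.BalabanUV.Beta.D1BFx.TorusGaugeBasis (What0)
open Summit.QuantumFields.BalabanUV.Beta.D1BFx.TorusGaugeBasisMatrix (Nhat)
open Summit.QuantumFields.BalabanUV.Beta.D1BFx.TorusCoframeJets (Djet Tjet₀ Tjet₁ Tjet₁₁ Ajet₀ Ajet₁ Ajet₁₁)
open Summit.QuantumFields.BalabanUV.Beta.D1BFx.RWeightedLegPack (NlegRoad)
open Summit.QuantumFields.BalabanUV.Beta.D1BFx.GaugeJetLocal (idK1)
open Summit.QuantumFields.BalabanUV.Beta.D1BFx.KGhostLeg (Cgh)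
open Summit.QuantumFields.BalabanUV.Beta.D1BFx.GhostStencil (ghCur)
open Summit.QuantumFields.BalabanUV.Beta.D1BFx.TorusGhostWordArrays (lapU Lgh)
open Summit.QuantumFields.BalabanUV.Beta.D1BFx.TorusGhostPairStencils (gh₂)
open Summit.QuantumFields.BalabanUV.Beta.D1BFx.CombFPWordArrays (nFcol)
open Summit.QuantumFields.BalabanUV.Beta.D1BFx.WardJetsFromNoether (oslot)
open Summit.QuantumFields.BalabanUV.Beta.D1BFx.ColourLiftAdE3 (c₃)
open Summit.QuantumFields.BalabanUV.Beta.D1BFx.PeriodicArrayWrapColH (colH_weight biLoc_sliceSum_images_colH tendsto_sliceSum_images_colH)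
open Summit.QuantumFields.BalabanUV.Beta.D1BFx.PackedDictionaryLetters (locStencil_mono body_mono packed_first_kkt packed_first_parity packed_second_kkt_sgn
  packed_second_parity)
open Summit.QuantumFields.BalabanUV.Beta.D1BFx.PackedBlockGlue (response_siteOf_eq_tsum_colH)
open Summit.QuantumFields.BalabanUV.Beta.D1BFx.PackedWardLettersSecond (packed_ward₂_field)
open Summit.QuantumFields.BalabanUV.Beta.D1BFx.PackedLettersAtSites (ffHat_packed₂_site mfHat_packed₂_site packed_ward₁_lifted_field vertex2OfK_eq_sliceSum)
open Summit.QuantumFields.BalabanUV.Beta.D1BFx.PackedLettersBlockCov (ffHat_packed_site_of_block mfHat_packed_site_of_block period₂_cov_of_block)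
open Summit.QuantumFields.BalabanUV.Beta.D1BFx.TorusBondArrays (dB dB_pos)
open Summit.QuantumFields.BalabanUV.Beta.D1BFx.PackedNSideDictionary (SN vertexFamily_vertexOfK_SN tj₂_packed_eq_blocksHat_vertexOfK_SN)
open ExpKernelCalculus (VertexFamily)
open Summit.QuantumFields.BalabanUV.Beta.D1BFx.PackedTowerCombine (hessKer_transfer_road_cov_packed_of_uniform)

open Summit.QuantumFields.BalabanUV.Beta.D1BFx.PackedKernelSplit (blk ffV ffW legCross blockTerms)
open Summit.QuantumFields.BalabanUV.Beta.D1BFx.ReducedKernelF (TOfLeg)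
open Summit.QuantumFields.BalabanUV.Beta.D1BFx.CoarseGramInverse (multM)
open Summit.QuantumFields.BalabanUV.Beta.D1BFx.RWeightedLegPack (sandP)
open Summit.QuantumFields.BalabanUV.Beta.D1BFx.GluonLeg (Ga)
open Summit.QuantumFields.BalabanUV.Beta.AxialDressingRooted (coProjBmAtK)
open Summit.QuantumFields.BalabanUV.Beta.TameKernelCalculus (Loc)
open Summit.QuantumFields.BalabanUV.Beta.D1BFx.PackedNSideDictionary (locStencil_SN)
open Summit.QuantumFields.BalabanUV.Beta.D1BFx.PackedLiteralCombineN (hessKer_transfer_road_cov_packed_literal_N)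
open Summit.QuantumFields.BalabanUV.Beta.D1BFx.PackedRoadSplit (hessKer_road_split_of_packed_identity)

open ExpKernelCalculus (tr)
open Summit.QuantumFields.BalabanUV.Beta.D1BFx.RProjector (Pgt)
open Summit.QuantumFields.BalabanUV.Beta.D1BFx.GhostLeg (Ggh)
open Summit.QuantumFields.BalabanUV.Beta.D1BFx.PackedRoadHptw (hessKer_road_hptw_shape)
open Summit.QuantumFields.BalabanUV.Beta.D1BFx.GhostSqrtLegPacked (hessKer_Cgh_packed_eq)

variable (m : ℕ) {a : ℝ} {r : Fin 4 → ℕ}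

/-- [folklore] **PART 7 «HPTW-GHOST»: THE (K) IDENTITY OF THE ROAD IN THE `hptw` SHAPE, GLUON AND GHOST MAIN WORDS EXPLICIT** (PART 6 + `hessKer_Cgh_packed_eq` at
`w := colH G₀ (m+1)`). -/
theorem hessKer_road_hptw_ghost_shape (ha : 0 < a) (hGa : Spr (GluonLeg.Ga (m + 1) a)) (hr : r ∈ box (3 + 1) (m + 1))
    -- the literal's first-derivative stencil family and its STRUCTURAL SOCKETS
    (S : Fin 4 → (Fin 4 → ℤ) → MKer 4 (Fib 3)) {Cs δS : ℝ} (hS : LocStencil S Cs δS) (hCs : 0 ≤ Cs) (hδS : 0 < δS)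
    (hScovB : ∀ κ' u t, S κ' (u + ((m + 1 : ℕ) : ℤ) • t) = shiftK (-(((m + 1 : ℕ) : ℤ) • t)) (S κ' u))
    (hSmm : ∀ κ' u x y (c b : Fin 4), S κ' u x y (Sum.inr c) (Sum.inr b) = 0)
    (hSfm : ∀ κ' u x y (c b : Fin 4), S κ' u x y (Sum.inl c) (Sum.inr b) = S κ' u y x (Sum.inr b) (Sum.inl c))
    (hSff : ∀ κ' u x y (c b : Fin 4), S κ' u x y (Sum.inl c) (Sum.inl b) = -S κ' u y x (Sum.inl b) (Sum.inl c))
    -- the literal's second-derivative stencil family and its STRUCTURAL SOCKETS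
    (S₂ : Fin 4 → (Fin 4 → ℤ) → Fin 4 → (Fin 4 → ℤ) → MKer 4 (Fib 3)) {Ck δ₂ : ℝ}
    (hS₂ : ∀ κ u κ' u', BiLoc (S₂ κ u κ' u') u u (Ck * Real.exp (-δ₂ * l1 (u' - u))) δ₂) (hCk : 0 ≤ Ck) (hδ₂ : 0 < δ₂)
    (hS₂covB : ∀ κ' κ'' u u' t, S₂ κ' (u + ((m + 1 : ℕ) : ℤ) • t) κ'' (u' + ((m + 1 : ℕ) : ℤ) • t)
      = shiftK (-(((m + 1 : ℕ) : ℤ) • t)) (S₂ κ' u κ'' u'))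
    (hS₂mm : ∀ κ u κ' u' x y (c b : Fin 4), S₂ κ u κ' u' x y (Sum.inr c) (Sum.inr b) = 0)
    (hS₂fm : ∀ κ u κ' u' x y (c b : Fin 4), S₂ κ u κ' u' x y (Sum.inl c) (Sum.inr b) = -S₂ κ u κ' u' y x (Sum.inr b) (Sum.inl c))
    (hS₂ff : ∀ κ u κ' u' x y (c b : Fin 4), S₂ κ u κ' u' x y (Sum.inl c) (Sum.inl b) = S₂ κ u κ' u' y x (Sum.inl b) (Sum.inl c))
    (μ ν : Fin 4) (z : Fin 4 → ℤ)
    {p : ℕ → ℕ} [∀ k, NeZero (p k)] (hp : Tendsto p atTop atTop)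
    -- the N side, SECOND ORDER ONLY (first order discharged by leaf-03's (D) PART I)
    (𝒲N : ℕ → Fin 4 → (Fin 4 → ℤ) → Fin 4 → (Fin 4 → ℤ) → MKer 4 (Fib 3)) (𝒲Ninf : Fin 4 → (Fin 4 → ℤ) → Fin 4 → (Fin 4 → ℤ) → MKer 4 (Fib 3))
    {CN δWN : ℝ}
    (hWN : ∀ k, BiLoc (𝒲N k μ 0 ν z) (((m + 1 : ℕ) : ℤ) • (0 : Fin 4 → ℤ)) (((m + 1 : ℕ) : ℤ) • z) CN δWN) (hδWN : 0 < δWN)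
    (hlimWN : ∀ x y c b, Tendsto (fun k => 𝒲N k μ 0 ν z x y c b) atTop (𝓝 (𝒲Ninf μ 0 ν z x y c b)))
    -- the responses PINNED to the columns of the torus comb-gauged KKT inverse
    (rS rT : ∀ k, I 3 (m + 1) (p k) → ℝ)
    (hrS : ∀ k i, rS k i = (kkt (Khat (d := 3) (m + 1) (p k)) (Matrix.fromRows (Qhat (d := 3) (m + 1) (p k)) (tauT (toSite r) (m + 1) (p k))))⁻¹
      (Sum.inl i) (Sum.inr (Sum.inl (siteOf 4 (p k) 0, μ))))
    (hrT : ∀ k i, rT k i = (kkt (Khat (d := 3) (m + 1) (p k)) (Matrix.fromRows (Qhat (d := 3) (m + 1) (p k)) (tauT (toSite r) (m + 1) (p k))))⁻¹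
      (Sum.inl i) (Sum.inr (Sum.inl (siteOf 4 (p k) z, ν))))
    -- co-frame data pinned to TB4-W's jets PACKED by the responses («COFRAME-PACK»), VERBATIM as in (B6′)
    (T₀ Tₛ Tₜ Tₛₜ : ∀ k, Matrix (CombRows (toSite r) (m + 1) (p k)) (I 3 (m + 1) (p k)) ℝ)
    (A₀ Aₛ Aₜ Aₛₜ : ∀ k, Matrix (CombRows (toSite r) (m + 1) (p k)) (CombRows (toSite r) (m + 1) (p k)) ℝ)
    (hT₀ : ∀ k, T₀ k = Tjet₀ ((m + 1) * p k) (Nhat r (m + 1) (p k)) (e₁ (m + 1) (p k)))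
    (hTₛ : ∀ k, Tₛ k = ∑ i : I 3 (m + 1) (p k), rS k i • Tjet₁ ((m + 1) * p k) (e₁ (m + 1) (p k) i) (Nhat r (m + 1) (p k)) (e₁ (m + 1) (p k)))
    (hTₜ : ∀ k, Tₜ k = ∑ i : I 3 (m + 1) (p k), rT k i • Tjet₁ ((m + 1) * p k) (e₁ (m + 1) (p k) i) (Nhat r (m + 1) (p k)) (e₁ (m + 1) (p k)))
    (hTₛₜ : ∀ k, Tₛₜ k = ∑ i : I 3 (m + 1) (p k), ∑ j : I 3 (m + 1) (p k), (rS k i * rT k j) •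
      Tjet₁₁ ((m + 1) * p k) (e₁ (m + 1) (p k) i) (e₁ (m + 1) (p k) j) (Nhat r (m + 1) (p k)) (e₁ (m + 1) (p k)))
    (hA₀ : ∀ k, A₀ k = Ajet₀ ((m + 1) * p k) (Nhat r (m + 1) (p k)))
    (hAₛ : ∀ k, Aₛ k = ∑ i : I 3 (m + 1) (p k), rS k i • Ajet₁ ((m + 1) * p k) (e₁ (m + 1) (p k) i) (Nhat r (m + 1) (p k)))
    (hAₜ : ∀ k, Aₜ k = ∑ i : I 3 (m + 1) (p k), rT k i • Ajet₁ ((m + 1) * p k) (e₁ (m + 1) (p k) i) (Nhat r (m + 1) (p k)))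
    (hAₛₜ : ∀ k, Aₛₜ k = ∑ i : I 3 (m + 1) (p k), ∑ j : I 3 (m + 1) (p k), (rS k i * rT k j) •
      Ajet₁₁ ((m + 1) * p k) (e₁ (m + 1) (p k) i) (e₁ (m + 1) (p k) j) (Nhat r (m + 1) (p k)))
    -- the literal's per-bond torus data PINNED to the periodised single-bond ∕ pair stencil arrays and THE CONVENTION's generator jets
    (K₁ : ∀ k, I 3 (m + 1) (p k) ⊕ J 3 (p k) → Matrix (I 3 (m + 1) (p k)) (I 3 (m + 1) (p k)) ℝ)
    (Q₁ : ∀ k, I 3 (m + 1) (p k) ⊕ J 3 (p k) → Matrix (J 3 (p k)) (I 3 (m + 1) (p k)) ℝ)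
    (x₁ : ∀ k, I 3 (m + 1) (p k) ⊕ J 3 (p k) → Matrix (I 3 (m + 1) (p k)) (CombRows (toSite r) (m + 1) (p k)) ℝ)
    (K₂ : ∀ k, I 3 (m + 1) (p k) ⊕ J 3 (p k) → I 3 (m + 1) (p k) ⊕ J 3 (p k) → Matrix (I 3 (m + 1) (p k)) (I 3 (m + 1) (p k)) ℝ)
    (Q₂ : ∀ k, I 3 (m + 1) (p k) ⊕ J 3 (p k) → I 3 (m + 1) (p k) ⊕ J 3 (p k) → Matrix (J 3 (p k)) (I 3 (m + 1) (p k)) ℝ)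
    (x₂ : ∀ k, I 3 (m + 1) (p k) ⊕ J 3 (p k) → I 3 (m + 1) (p k) ⊕ J 3 (p k) → Matrix (I 3 (m + 1) (p k)) (CombRows (toSite r) (m + 1) (p k)) ℝ)
    (hK₁ : ∀ k i, K₁ k (Sum.inl i) = Matrix.of (periodiseF (p k) (fTL (sortK (m + 1) (arr ((m + 1) * p k)
      (S i.2.2 (windowMap 4 ((m + 1) * p k) (torusBlockEquiv (m + 1) (p k) (i.1, i.2.1)))))))))
    (hQ₁ : ∀ k i, Q₁ k (Sum.inl i) = Matrix.of (periodiseF (p k) (fBL (sortK (m + 1) (arr ((m + 1) * p k)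
      (S i.2.2 (windowMap 4 ((m + 1) * p k) (torusBlockEquiv (m + 1) (p k) (i.1, i.2.1)))))))))
    (hx₁ : ∀ k i, x₁ k (Sum.inl i) = (Djet ((m + 1) * p k) (e₁ (m + 1) (p k) i)).submatrix (e₁ (m + 1) (p k)) id * Nhat r (m + 1) (p k))
    (hK₂ : ∀ k i j, K₂ k (Sum.inl i) (Sum.inl j) = Matrix.of (periodiseF (p k) (fTL (sortK (m + 1) (fun x y c b => ∑' t : Fin 4 → ℤ,
      arr ((m + 1) * p k) (S₂ i.2.2 (windowMap 4 ((m + 1) * p k) (torusBlockEquiv (m + 1) (p k) (i.1, i.2.1))) j.2.2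
        (imageShift ((m + 1) * p k) (windowMap 4 ((m + 1) * p k) (torusBlockEquiv (m + 1) (p k) (j.1, j.2.1))) t)) x y c b)))))
    (hQ₂ : ∀ k i j, Q₂ k (Sum.inl i) (Sum.inl j) = Matrix.of (periodiseF (p k) (fBL (sortK (m + 1) (fun x y c b => ∑' t : Fin 4 → ℤ,
      arr ((m + 1) * p k) (S₂ i.2.2 (windowMap 4 ((m + 1) * p k) (torusBlockEquiv (m + 1) (p k) (i.1, i.2.1))) j.2.2
        (imageShift ((m + 1) * p k) (windowMap 4 ((m + 1) * p k) (torusBlockEquiv (m + 1) (p k) (j.1, j.2.1))) t)) x y c b)))))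
    (hx₂ : ∀ k i j, x₂ k (Sum.inl i) (Sum.inl j) = if i = j then x₁ k (Sum.inl i) else 0)
    (hK₁0 : ∀ k j, K₁ k (Sum.inr j) = 0) (hQ₁0 : ∀ k j, Q₁ k (Sum.inr j) = 0) (hx₁0 : ∀ k j, x₁ k (Sum.inr j) = 0)
    (hK₂0 : ∀ k j q, K₂ k (Sum.inr j) q = 0) (hK₂0' : ∀ k q j, K₂ k q (Sum.inr j) = 0)
    (hQ₂0 : ∀ k j q, Q₂ k (Sum.inr j) q = 0) (hQ₂0' : ∀ k q j, Q₂ k q (Sum.inr j) = 0)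
    (hx₂0 : ∀ k j q, x₂ k (Sum.inr j) q = 0) (hx₂0' : ∀ k q j, x₂ k q (Sum.inr j) = 0)
    -- the literal's LIFTED table-level Ward identities [P1′]∕[P2′] in the `ad e₃` model (ρ-g16-1′), per torus
    (C : Fin 3 → Matrix (Fin 3) (Fin 3) ℝ) (hC : C 2 = c₃)
    (hP1 : ∀ k, ∀ q : Fin 3 × (I 3 (m + 1) (p k) ⊕ J 3 (p k)),
      (C q.1 ⊗ₖ kkt (K₁ k q.2) (Q₁ k q.2))
          * ((1 : Matrix (Fin 3) (Fin 3) ℝ) ⊗ₖ Matrix.fromRows (What0 r (m + 1) (p k)) (0 : Matrix (J 3 (p k)) (CombRows (toSite r) (m + 1) (p k)) ℝ))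
      + ((1 : Matrix (Fin 3) (Fin 3) ℝ) ⊗ₖ kkt (Khat (d := 3) (m + 1) (p k)) (Qhat (d := 3) (m + 1) (p k)))
          * (C q.1 ⊗ₖ Matrix.fromRows (x₁ k q.2) (0 : Matrix (J 3 (p k)) (CombRows (toSite r) (m + 1) (p k)) ℝ))
      + oslot (fun q' : Fin 3 × (I 3 (m + 1) (p k) ⊕ J 3 (p k)) =>
            C q'.1 ⊗ₖ Matrix.fromRows (x₁ k q'.2) (0 : Matrix (J 3 (p k)) (CombRows (toSite r) (m + 1) (p k)) ℝ))
          (fun i => ((1 : Matrix (Fin 3) (Fin 3) ℝ) ⊗ₖ kkt (Khat (d := 3) (m + 1) (p k)) (Qhat (d := 3) (m + 1) (p k))) i q) = 0)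
    (hP2 : ∀ k, ∀ q q'' : Fin 3 × (I 3 (m + 1) (p k) ⊕ J 3 (p k)),
      ((C q.1 * C q''.1) ⊗ₖ kkt (K₂ k q.2 q''.2) (Q₂ k q.2 q''.2))
          * ((1 : Matrix (Fin 3) (Fin 3) ℝ) ⊗ₖ Matrix.fromRows (What0 r (m + 1) (p k)) (0 : Matrix (J 3 (p k)) (CombRows (toSite r) (m + 1) (p k)) ℝ))
      + (C q.1 ⊗ₖ kkt (K₁ k q.2) (Q₁ k q.2))
          * (C q''.1 ⊗ₖ Matrix.fromRows (x₁ k q''.2) (0 : Matrix (J 3 (p k)) (CombRows (toSite r) (m + 1) (p k)) ℝ))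
      + (C q''.1 ⊗ₖ kkt (K₁ k q''.2) (Q₁ k q''.2))
          * (C q.1 ⊗ₖ Matrix.fromRows (x₁ k q.2) (0 : Matrix (J 3 (p k)) (CombRows (toSite r) (m + 1) (p k)) ℝ))
      + ((1 : Matrix (Fin 3) (Fin 3) ℝ) ⊗ₖ kkt (Khat (d := 3) (m + 1) (p k)) (Qhat (d := 3) (m + 1) (p k)))
          * ((C q.1 * C q''.1) ⊗ₖ Matrix.fromRows (x₂ k q.2 q''.2) (0 : Matrix (J 3 (p k)) (CombRows (toSite r) (m + 1) (p k)) ℝ))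
      + oslot (fun q' : Fin 3 × (I 3 (m + 1) (p k) ⊕ J 3 (p k)) =>
            C q'.1 ⊗ₖ Matrix.fromRows (x₁ k q'.2) (0 : Matrix (J 3 (p k)) (CombRows (toSite r) (m + 1) (p k)) ℝ))
          (fun i => (C q''.1 ⊗ₖ kkt (K₁ k q''.2) (Q₁ k q''.2)) i q)
      + oslot (fun q' : Fin 3 × (I 3 (m + 1) (p k) ⊕ J 3 (p k)) =>
            (C q''.1 * C q'.1) ⊗ₖ Matrix.fromRows (x₂ k q''.2 q'.2) (0 : Matrix (J 3 (p k)) (CombRows (toSite r) (m + 1) (p k)) ℝ))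
          (fun i => ((1 : Matrix (Fin 3) (Fin 3) ℝ) ⊗ₖ kkt (Khat (d := 3) (m + 1) (p k)) (Qhat (d := 3) (m + 1) (p k))) i q)
      + oslot (fun p' : Fin 3 × (I 3 (m + 1) (p k) ⊕ J 3 (p k)) =>
            (C q.1 * C p'.1) ⊗ₖ Matrix.fromRows (x₂ k q.2 p'.2) (0 : Matrix (J 3 (p k)) (CombRows (toSite r) (m + 1) (p k)) ℝ))
          (fun i => ((1 : Matrix (Fin 3) (Fin 3) ℝ) ⊗ₖ kkt (Khat (d := 3) (m + 1) (p k)) (Qhat (d := 3) (m + 1) (p k))) i q'') = 0)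
    -- the parity-typed form ∕ constraint jets PINNED to the blocks of the periodised packed tables
    (kₛ kₜ kₛₜ : ∀ k, Matrix (I 3 (m + 1) (p k)) (I 3 (m + 1) (p k)) ℝ) (qₛ qₜ qₛₜ : ∀ k, Matrix (J 3 (p k)) (I 3 (m + 1) (p k)) ℝ)
    (hkₛ : ∀ k, kₛ k = Matrix.of (periodiseF (p k) (fTL (sortK (m + 1) (arr ((m + 1) * p k)
      (vertexOfK (coDressKBmAt (toSite r) (m + 1) (KInvStep (d := 3) (m + 1) 0)) (m + 1) S μ 0))))))
    (hqₛ : ∀ k, qₛ k = Matrix.of (periodiseF (p k) (fBL (sortK (m + 1) (arr ((m + 1) * p k)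
      (vertexOfK (coDressKBmAt (toSite r) (m + 1) (KInvStep (d := 3) (m + 1) 0)) (m + 1) S μ 0))))))
    (hkₜ : ∀ k, kₜ k = Matrix.of (periodiseF (p k) (fTL (sortK (m + 1) (arr ((m + 1) * p k)
      (vertexOfK (coDressKBmAt (toSite r) (m + 1) (KInvStep (d := 3) (m + 1) 0)) (m + 1) S ν z))))))
    (hqₜ : ∀ k, qₜ k = Matrix.of (periodiseF (p k) (fBL (sortK (m + 1) (arr ((m + 1) * p k)
      (vertexOfK (coDressKBmAt (toSite r) (m + 1) (KInvStep (d := 3) (m + 1) 0)) (m + 1) S ν z))))))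
    (hkₛₜ : ∀ k, kₛₜ k = Matrix.of (periodiseF (p k) (fTL (sortK (m + 1) (arr ((m + 1) * p k) (fun x y c b => ∑ κ' : Fin 4, ∑ κ'' : Fin 4,
      wsum (colH (coDressKBmAt (toSite r) (m + 1) (KInvStep (d := 3) (m + 1) 0)) (m + 1) μ 0 κ')
        (fun u => wsum (fun u'' => ∑' t : Fin 4 → ℤ,
          colH (coDressKBmAt (toSite r) (m + 1) (KInvStep (d := 3) (m + 1) 0)) (m + 1) ν z κ'' (imageShift ((m + 1) * p k) u'' t)) (S₂ κ' u κ''))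
        x y c b))))))
    (hqₛₜ : ∀ k, qₛₜ k = Matrix.of (periodiseF (p k) (fBL (sortK (m + 1) (arr ((m + 1) * p k) (fun x y c b => ∑ κ' : Fin 4, ∑ κ'' : Fin 4,
      wsum (colH (coDressKBmAt (toSite r) (m + 1) (KInvStep (d := 3) (m + 1) 0)) (m + 1) μ 0 κ')
        (fun u => wsum (fun u'' => ∑' t : Fin 4 → ℤ,
          colH (coDressKBmAt (toSite r) (m + 1) (KInvStep (d := 3) (m + 1) 0)) (m + 1) ν z κ'' (imageShift ((m + 1) * p k) u'' t)) (S₂ κ' u κ''))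
        x y c b))))))
    -- the (A2-N) dictionary AT THE k-TH TABLES, SECOND ORDER ONLY
    (hJN'' : ∀ k, kkt (kₛₜ k + tgramMix (T₀ k) (Tₛ k) (Tₜ k) (Tₛₜ k) (A₀ k) (Aₛ k) (Aₜ k) (Aₛₜ k)) (qₛₜ k)
        = blocksHat (p k) (sortK (m + 1) (arr ((m + 1) * p k) (𝒲N k μ 0 ν z))))
    (hWNloc : ∀ μ' y ν' y', Loc (𝒲Ninf μ' y ν' y')) :
    hessKer (coDressKBmAt (toSite r) (m + 1) (KInvStep (d := 3) (m + 1) 0))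
          (vertexOfK (coDressKBmAt (toSite r) (m + 1) (KInvStep (d := 3) (m + 1) 0)) (m + 1) S)
          (vertex2OfK (coDressKBmAt (toSite r) (m + 1) (KInvStep (d := 3) (m + 1) 0)) (m + 1) S₂) μ ν z
      = ((2 : ℝ)⁻¹) ^ 2 * TOfLeg (m + 1) (Ga (m + 1) a) (fun κ u => blk (coProjBmAtK (toSite r) (m + 1) (SN m a S) κ u) true true)
            (fun μ' y ν' y' => ((2 : ℝ)⁻¹)⁻¹ • ffW 𝒲Ninf μ' y ν' y') μ ν z
        + legCross ((2 : ℝ)⁻¹ • Ga (m + 1) a)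
            ((-(2 : ℝ)⁻¹) • blk (sandP (m + 1) (Ga (m + 1) a) (multM (m + 1) (2 * a / ((m + 1 : ℕ) : ℝ) ^ 8) 2)) true true)
            (ffV (vertexOfK (coDressKBmAt (toSite r) (m + 1) (KInvStep (d := 3) (m + 1) 0)) (m + 1) (SN m a S))) (ffW 𝒲Ninf) μ ν z
        + blockTerms (NlegRoad m a) (vertexOfK (coDressKBmAt (toSite r) (m + 1) (KInvStep (d := 3) (m + 1) 0)) (m + 1) (SN m a S)) 𝒲Ninf μ ν z
        + 2 * hessKer idK1
          (fun κ' v => fun x y c b => ∑ κ : Fin 4, wsum (colH (coDressKBmAt (toSite r) (m + 1) (KInvStep (d := 3) (m + 1) 0)) (m + 1) κ' v κ) (nFcol r (m + 1) κ) x y c b)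
          (fun κ' v l v' => fun x y c b => ∑ κ : Fin 4, wsum (colH (coDressKBmAt (toSite r) (m + 1) (KInvStep (d := 3) (m + 1) 0)) (m + 1) κ' v κ)
            (fun u => fun x y c b => colH (coDressKBmAt (toSite r) (m + 1) (KInvStep (d := 3) (m + 1) 0)) (m + 1) l v' κ u * nFcol r (m + 1) κ u x y c b) x y c b)
          μ ν z
        - (2 * hessKer (Ggh (m + 1) a) (fun κ' v => (((m + 1 : ℕ) : ℝ) ^ 2) • (fun x y a b => ∑ κ : Fin 4, wsum (colH (coDressKBmAt (toSite r) (m + 1) (KInvStep (d := 3) (m + 1) 0)) (m + 1) κ' v κ) (ghCur κ) x y a b))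
          (fun κ' v l v' => (((m + 1 : ℕ) : ℝ) ^ 2) • (fun x y a b => ∑ κ : Fin 4,
            wsum (colH (coDressKBmAt (toSite r) (m + 1) (KInvStep (d := 3) (m + 1) 0)) (m + 1) κ' v κ) (fun u => fun x y a b => colH (coDressKBmAt (toSite r) (m + 1) (KInvStep (d := 3) (m + 1) 0)) (m + 1) l v' κ u * gh₂ κ u x y a b) x y a b)) μ ν z
        - ((1 / 2) * (tr (comp (comp (Pgt (m + 1) a) (Ggh (m + 1) a))
              ((((m + 1 : ℕ) : ℝ) ^ 2) • (fun x y a b => ∑ κ : Fin 4, wsum (colH (coDressKBmAt (toSite r) (m + 1) (KInvStep (d := 3) (m + 1) 0)) (m + 1) μ 0 κ) (fun u => fun x y a b => colH (coDressKBmAt (toSite r) (m + 1) (KInvStep (d := 3) (m + 1) 0)) (m + 1) ν z κ u * gh₂ κ u x y a b) x y a b)))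
            + tr (comp (comp (Ggh (m + 1) a) (Pgt (m + 1) a))
              ((((m + 1 : ℕ) : ℝ) ^ 2) • (fun x y a b => ∑ κ : Fin 4, wsum (colH (coDressKBmAt (toSite r) (m + 1) (KInvStep (d := 3) (m + 1) 0)) (m + 1) μ 0 κ) (fun u => fun x y a b => colH (coDressKBmAt (toSite r) (m + 1) (KInvStep (d := 3) (m + 1) 0)) (m + 1) ν z κ u * gh₂ κ u x y a b) x y a b)))
            + tr (comp (comp (comp (Ggh (m + 1) a) (comp (Pgt (m + 1) a) (Ggh (m + 1) a))) ((((m + 1 : ℕ) : ℝ) ^ 2) • (fun x y a b => ∑ κ : Fin 4, wsum (colH (coDressKBmAt (toSite r) (m + 1) (KInvStep (d := 3) (m + 1) 0)) (m + 1) μ 0 κ) (ghCur κ) x y a b)))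
              ((((m + 1 : ℕ) : ℝ) ^ 2) • (fun x y a b => ∑ κ : Fin 4, wsum (colH (coDressKBmAt (toSite r) (m + 1) (KInvStep (d := 3) (m + 1) 0)) (m + 1) ν z κ) (ghCur κ) x y a b)))
            + tr (comp (comp (comp (Ggh (m + 1) a) (comp (Pgt (m + 1) a) (Ggh (m + 1) a))) ((((m + 1 : ℕ) : ℝ) ^ 2) • (fun x y a b => ∑ κ : Fin 4, wsum (colH (coDressKBmAt (toSite r) (m + 1) (KInvStep (d := 3) (m + 1) 0)) (m + 1) ν z κ) (ghCur κ) x y a b)))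
              ((((m + 1 : ℕ) : ℝ) ^ 2) • (fun x y a b => ∑ κ : Fin 4, wsum (colH (coDressKBmAt (toSite r) (m + 1) (KInvStep (d := 3) (m + 1) 0)) (m + 1) μ 0 κ) (ghCur κ) x y a b))))
          - (1 / 2) * (tr (comp (comp (Ggh (m + 1) a) ((((m + 1 : ℕ) : ℝ) ^ 2) • (fun x y a b => ∑ κ : Fin 4, wsum (colH (coDressKBmAt (toSite r) (m + 1) (KInvStep (d := 3) (m + 1) 0)) (m + 1) μ 0 κ) (ghCur κ) x y a b))) (comp (comp (Pgt (m + 1) a) (Ggh (m + 1) a))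
              ((((m + 1 : ℕ) : ℝ) ^ 2) • (fun x y a b => ∑ κ : Fin 4, wsum (colH (coDressKBmAt (toSite r) (m + 1) (KInvStep (d := 3) (m + 1) 0)) (m + 1) ν z κ) (ghCur κ) x y a b))))
            + tr (comp (comp (comp (Pgt (m + 1) a) (Ggh (m + 1) a)) ((((m + 1 : ℕ) : ℝ) ^ 2) • (fun x y a b => ∑ κ : Fin 4, wsum (colH (coDressKBmAt (toSite r) (m + 1) (KInvStep (d := 3) (m + 1) 0)) (m + 1) μ 0 κ) (ghCur κ) x y a b))) (comp (Ggh (m + 1) a)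
              ((((m + 1 : ℕ) : ℝ) ^ 2) • (fun x y a b => ∑ κ : Fin 4, wsum (colH (coDressKBmAt (toSite r) (m + 1) (KInvStep (d := 3) (m + 1) 0)) (m + 1) ν z κ) (ghCur κ) x y a b))))
            + tr (comp (comp (comp (Ggh (m + 1) a) (Ggh (m + 1) a)) ((((m + 1 : ℕ) : ℝ) ^ 2) • (fun x y a b => ∑ κ : Fin 4, wsum (colH (coDressKBmAt (toSite r) (m + 1) (KInvStep (d := 3) (m + 1) 0)) (m + 1) μ 0 κ) (ghCur κ) x y a b))) (comp (Pgt (m + 1) a)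
              ((((m + 1 : ℕ) : ℝ) ^ 2) • (fun x y a b => ∑ κ : Fin 4, wsum (colH (coDressKBmAt (toSite r) (m + 1) (KInvStep (d := 3) (m + 1) 0)) (m + 1) ν z κ) (ghCur κ) x y a b))))
            + tr (comp (comp (comp (Ggh (m + 1) a) (comp (Pgt (m + 1) a) (Ggh (m + 1) a))) ((((m + 1 : ℕ) : ℝ) ^ 2) • (fun x y a b => ∑ κ : Fin 4, wsum (colH (coDressKBmAt (toSite r) (m + 1) (KInvStep (d := 3) (m + 1) 0)) (m + 1) μ 0 κ) (ghCur κ) x y a b)))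
              ((((m + 1 : ℕ) : ℝ) ^ 2) • (fun x y a b => ∑ κ : Fin 4, wsum (colH (coDressKBmAt (toSite r) (m + 1) (KInvStep (d := 3) (m + 1) 0)) (m + 1) ν z κ) (ghCur κ) x y a b)))
            + tr (comp (comp (comp (Ggh (m + 1) a) (comp (Pgt (m + 1) a) (Ggh (m + 1) a))) ((((m + 1 : ℕ) : ℝ) ^ 2) • (fun x y a b => ∑ κ : Fin 4, wsum (colH (coDressKBmAt (toSite r) (m + 1) (KInvStep (d := 3) (m + 1) 0)) (m + 1) ν z κ) (ghCur κ) x y a b)))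
              ((((m + 1 : ℕ) : ℝ) ^ 2) • (fun x y a b => ∑ κ : Fin 4, wsum (colH (coDressKBmAt (toSite r) (m + 1) (KInvStep (d := 3) (m + 1) 0)) (m + 1) μ 0 κ) (ghCur κ) x y a b)))
            + tr (comp (comp (Pgt (m + 1) a) ((((m + 1 : ℕ) : ℝ) ^ 2) • (fun x y a b => ∑ κ : Fin 4, wsum (colH (coDressKBmAt (toSite r) (m + 1) (KInvStep (d := 3) (m + 1) 0)) (m + 1) μ 0 κ) (ghCur κ) x y a b))) (comp (comp (Ggh (m + 1) a) (Ggh (m + 1) a))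
              ((((m + 1 : ℕ) : ℝ) ^ 2) • (fun x y a b => ∑ κ : Fin 4, wsum (colH (coDressKBmAt (toSite r) (m + 1) (KInvStep (d := 3) (m + 1) 0)) (m + 1) ν z κ) (ghCur κ) x y a b))))
            + tr (comp (comp (Ggh (m + 1) a) ((((m + 1 : ℕ) : ℝ) ^ 2) • (fun x y a b => ∑ κ : Fin 4, wsum (colH (coDressKBmAt (toSite r) (m + 1) (KInvStep (d := 3) (m + 1) 0)) (m + 1) μ 0 κ) (ghCur κ) x y a b))) (comp (comp (Ggh (m + 1) a) (Pgt (m + 1) a))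
              ((((m + 1 : ℕ) : ℝ) ^ 2) • (fun x y a b => ∑ κ : Fin 4, wsum (colH (coDressKBmAt (toSite r) (m + 1) (KInvStep (d := 3) (m + 1) 0)) (m + 1) ν z κ) (ghCur κ) x y a b))))
            + tr (comp (comp (comp (Ggh (m + 1) a) (Pgt (m + 1) a)) ((((m + 1 : ℕ) : ℝ) ^ 2) • (fun x y a b => ∑ κ : Fin 4, wsum (colH (coDressKBmAt (toSite r) (m + 1) (KInvStep (d := 3) (m + 1) 0)) (m + 1) μ 0 κ) (ghCur κ) x y a b))) (comp (Ggh (m + 1) a)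
              ((((m + 1 : ℕ) : ℝ) ^ 2) • (fun x y a b => ∑ κ : Fin 4, wsum (colH (coDressKBmAt (toSite r) (m + 1) (KInvStep (d := 3) (m + 1) 0)) (m + 1) ν z κ) (ghCur κ) x y a b)))))
          + (1 / 2) * (tr (comp (comp (comp (Pgt (m + 1) a) (Ggh (m + 1) a)) ((((m + 1 : ℕ) : ℝ) ^ 2) • (fun x y a b => ∑ κ : Fin 4, wsum (colH (coDressKBmAt (toSite r) (m + 1) (KInvStep (d := 3) (m + 1) 0)) (m + 1) μ 0 κ) (ghCur κ) x y a b)))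
              (comp (comp (Pgt (m + 1) a) (Ggh (m + 1) a)) ((((m + 1 : ℕ) : ℝ) ^ 2) • (fun x y a b => ∑ κ : Fin 4, wsum (colH (coDressKBmAt (toSite r) (m + 1) (KInvStep (d := 3) (m + 1) 0)) (m + 1) ν z κ) (ghCur κ) x y a b))))
            + tr (comp (comp (comp (Ggh (m + 1) a) (comp (Pgt (m + 1) a) (Ggh (m + 1) a))) ((((m + 1 : ℕ) : ℝ) ^ 2) • (fun x y a b => ∑ κ : Fin 4, wsum (colH (coDressKBmAt (toSite r) (m + 1) (KInvStep (d := 3) (m + 1) 0)) (m + 1) μ 0 κ) (ghCur κ) x y a b))) (comp (Pgt (m + 1) a)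
              ((((m + 1 : ℕ) : ℝ) ^ 2) • (fun x y a b => ∑ κ : Fin 4, wsum (colH (coDressKBmAt (toSite r) (m + 1) (KInvStep (d := 3) (m + 1) 0)) (m + 1) ν z κ) (ghCur κ) x y a b))))
            + tr (comp (comp (Pgt (m + 1) a) ((((m + 1 : ℕ) : ℝ) ^ 2) • (fun x y a b => ∑ κ : Fin 4, wsum (colH (coDressKBmAt (toSite r) (m + 1) (KInvStep (d := 3) (m + 1) 0)) (m + 1) μ 0 κ) (ghCur κ) x y a b))) (comp (comp (Ggh (m + 1) a) (comp (Pgt (m + 1) a) (Ggh (m + 1) a)))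
              ((((m + 1 : ℕ) : ℝ) ^ 2) • (fun x y a b => ∑ κ : Fin 4, wsum (colH (coDressKBmAt (toSite r) (m + 1) (KInvStep (d := 3) (m + 1) 0)) (m + 1) ν z κ) (ghCur κ) x y a b))))
            + tr (comp (comp (comp (Ggh (m + 1) a) (Pgt (m + 1) a)) ((((m + 1 : ℕ) : ℝ) ^ 2) • (fun x y a b => ∑ κ : Fin 4, wsum (colH (coDressKBmAt (toSite r) (m + 1) (KInvStep (d := 3) (m + 1) 0)) (m + 1) μ 0 κ) (ghCur κ) x y a b))) (comp (comp (Ggh (m + 1) a) (Pgt (m + 1) a))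
              ((((m + 1 : ℕ) : ℝ) ^ 2) • (fun x y a b => ∑ κ : Fin 4, wsum (colH (coDressKBmAt (toSite r) (m + 1) (KInvStep (d := 3) (m + 1) 0)) (m + 1) ν z κ) (ghCur κ) x y a b)))))))   := by
  -- the weights' decay letters at the two coarse bonds (rate `min δG ½ ≤ ½`)
  obtain ⟨δG, CG, hδG, hCG, hG⟩ := decays_coDressKBmAt_KInvStep (d := 3) hr 0
  have hwS : ∀ κ u, |colH (coDressKBmAt (toSite r) (m + 1) (KInvStep (d := 3) (m + 1) 0)) (m + 1) μ 0 κ u|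
      ≤ CG * Real.exp (-(min δG (1 / 2)) * l1 (u - ((m + 1 : ℕ) : ℤ) • (0 : Fin 4 → ℤ))) := fun κ u => colH_weight hG hCG (min_le_left _ _) μ 0 κ u
  have hwT : ∀ κ u, |colH (coDressKBmAt (toSite r) (m + 1) (KInvStep (d := 3) (m + 1) 0)) (m + 1) ν z κ u|
      ≤ CG * Real.exp (-(min δG (1 / 2)) * l1 (u - ((m + 1 : ℕ) : ℤ) • z)) := fun κ u => colH_weight hG hCG (min_le_left _ _) ν z κ u
  rw [hessKer_road_hptw_shape m ha hGa hr S hS hCs hδS hScovB hSmm hSfm hSff S₂ hS₂ hCk hδ₂ hS₂covB hS₂mm hS₂fm hS₂ff μ ν z hp 𝒲N 𝒲Ninf hWN hδWN hlimWN rS rT hrS hrT T₀ Tₛ Tₜ Tₛₜ A₀ Aₛ Aₜ Aₛₜ hT₀ hTₛ hTₜ hTₛₜ hA₀ hAₛ hAₜ hAₛₜ K₁ Q₁ x₁ K₂ Q₂ x₂ hK₁ hQ₁ hx₁ hK₂ hQ₂ hx₂ hK₁0 hQ₁0 hx₁0 hK₂0 hK₂0' hQ₂0 hQ₂0' hx₂0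 hx₂0' C hC hP1 hP2 kₛ kₜ kₛₜ qₛ qₜ qₛₜ hkₛ hqₛ hkₜ hqₜ hkₛₜ hqₛₜ hJN'' hWNloc,
    hessKer_Cgh_packed_eq (m + 1) ha (colH (coDressKBmAt (toSite r) (m + 1) (KInvStep (d := 3) (m + 1) 0)) (m + 1)) μ ν z hwS hwT
      (lt_min hδG one_half_pos) (min_le_right _ _)]

end Summit.QuantumFields.BalabanUV.Beta.D1BFx.PackedRoadHptwGhost

end
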